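import Literature.Analysis.FluidPDE.ConvexIntegration2DSliceCalculus
import HarnessLib

/-!
# Convex integration in 2-D, sliced: planar ball volumes and uniform slice near-orthogonality of localized plane waves

Topic `Analysis/FluidPDE`. Support file (sliced layer 3) for the proof of Székelyhidi's
localized convex-integration theorem `Torus.Szekelyhidi2011_thm13`
(`EulerSubsolutionCriterion.lean`; = De Lellis–Székelyhidi 2010, Prop. 2 in its every-time-slice
form). Two groups of elementary tools used by the sliced perturbation step
(`ConvexIntegration2DSlicedStep.lean`):

* volumes of planar discs (`volume_real_ball_E2`: `|B(x, r)| = r² |B(0, 1)|`, by the scaling of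
  the additive Haar measure; no value of `π` is needed anywhere), the thin annulus
  `|B(x, R + a) \ B(x, R - a)| = 4 R a |B(0,1)|` and the rim `|B(x, R)| - |B(x, R - a)| ≤ 2 R a |B(0,1)|`;
* for a localized plane wave `d.wave N` (CDK 2015, Prop. 4.1, `ConvexIntegration2DPlaneWaves.lean`)
  the near-orthogonality of its time slices to *all* normalized `C¹` amplitudes at once,
  uniformly in time: for every `ε > 0`, eventually in `N`, for all `t` and all `g ∈ C¹(ℝ²)` with
  `|g| ≤ 1`, `‖∇g‖ ≤ 1`, `|∫ wave_N,i(t,x) g(x) dx| ≤ ε` (`wave_slice_integral_uniform_eventually`;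
  DLSz 2010, §4.5 Step 3 and Lemma 4.9, quantitative: one integration by parts in `x` against
  the spatial part of the frequency). This is the estimate that makes the limit of the sliced
  iteration weakly continuous in time (`C(ℝ; L²_w)`).

## References

* C. De Lellis, L. Székelyhidi Jr., Arch. Ration. Mech. Anal. 195 (2010) 225–260, Lemma 4.9,
  §4.5 (Steps 2–3).
* E. Chiodaroli, C. De Lellis, O. Kreml, Comm. Pure Appl. Math. 68 (2015) 1157–1190, Prop. 4.1.
-/

noncomputable section

open MeasureTheory Set Metric Filter Function
open scoped ContDiff Topology

namespace Literature.Analysis.FluidPDE.ConvexIntegration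

/-! ### Volumes of planar discs -/

/-- **Scaling of disc areas:** `|B(x, r)| = r² |B(0, 1)|` in `ℝ²`. [folklore] -/
theorem volume_real_ball_E2 (x : E2) {r : ℝ} (hr : 0 ≤ r) :
    volume.real (ball x r) = r ^ 2 * volume.real (ball (0 : E2) 1) := by
  have hfin : Module.finrank ℝ E2 = 2 := finrank_euclideanSpace_fin
  rw [measureReal_def, Measure.addHaar_ball volume x hr, hfin, ENNReal.toReal_mul,
    ENNReal.toReal_ofReal (pow_nonneg hr 2), measureReal_def]

/-- The unit disc has positive area. [folklore] -/
theorem volume_real_unitBall_E2_pos : 0 < volume.real (ball (0 : E2) 1) :=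
  ENNReal.toReal_pos (measure_ball_pos volume (0 : E2) one_pos).ne' measure_ball_lt_top.ne

/-- Discs of positive radius have positive area. [folklore] -/
theorem volume_real_ball_E2_pos (x : E2) {r : ℝ} (hr : 0 < r) : 0 < volume.real (ball x r) :=
  ENNReal.toReal_pos (measure_ball_pos volume x hr).ne' measure_ball_lt_top.ne

/-- `|B(x, r/2)| = |B(x, r)| / 4` in `ℝ²`. [folklore] -/
theorem volume_real_ball_half_E2 (x : E2) {r : ℝ} (hr : 0 ≤ r) :
    volume.real (ball x (r / 2)) = volume.real (ball x r) / 4 := by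
  rw [volume_real_ball_E2 x hr, volume_real_ball_E2 x (by linarith : 0 ≤ r / 2)]
  ring

/-- `|B(x, 2r)| = 4 |B(x, r)|` and more generally `|B(x, c r)| = c² |B(y, r)|`. [folklore] -/
theorem volume_real_ball_mul_E2 (x y : E2) {c r : ℝ} (hc : 0 ≤ c) (hr : 0 ≤ r) :
    volume.real (ball x (c * r)) = c ^ 2 * volume.real (ball y r) := by
  rw [volume_real_ball_E2 x (mul_nonneg hc hr), volume_real_ball_E2 y hr]
  ring

/-- **The thin annulus:** `|B(x, R + a) \ B(x, R - a)| = 4 R a |B(0, 1)|` for `0 ≤ a ≤ R`.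
[folklore] -/
theorem volume_real_annulus_E2 (x : E2) {R a : ℝ} (ha : 0 ≤ a) (haR : a ≤ R) :
    volume.real (ball x (R + a) \ ball x (R - a)) = 4 * R * a * volume.real (ball (0 : E2) 1) := by
  rw [measureReal_sdiff (ball_subset_ball (by linarith)) measurableSet_ball measure_ball_lt_top.ne,
    volume_real_ball_E2 x (by linarith : 0 ≤ R + a), volume_real_ball_E2 x (by linarith : 0 ≤ R - a)]
  ring

/-- **The rim:** `|B(x, R)| - |B(x, R - a)| ≤ 2 R a |B(0, 1)|` for `0 ≤ a ≤ R`. [folklore] -/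
theorem volume_real_ball_sub_le_E2 (x : E2) {R a : ℝ} (ha : 0 ≤ a) (haR : a ≤ R) :
    volume.real (ball x R) - volume.real (ball x (R - a)) ≤ 2 * R * a * volume.real (ball (0 : E2) 1) := by
  rw [volume_real_ball_E2 x (by linarith : 0 ≤ R), volume_real_ball_E2 x (by linarith : 0 ≤ R - a)]
  have hV := volume_real_unitBall_E2_pos.le
  nlinarith [mul_nonneg (mul_nonneg ha ha) hV]

/-- Measure of the part of a disc not covered by a smaller concentric disc's superset:
if `B(x, R - a) ⊆ S ⊆ B(x, R)` (`S` measurable) then `|B(x,R) \ S| ≤ 2 R a |B(0,1)|`. [folklore] -/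
theorem volume_real_ball_diff_le_E2 (x : E2) {R a : ℝ} (ha : 0 ≤ a) (haR : a ≤ R) {S : Set E2}
    (hS : MeasurableSet S) (h1 : ball x (R - a) ⊆ S) (h2 : S ⊆ ball x R) :
    volume.real (ball x R \ S) ≤ 2 * R * a * volume.real (ball (0 : E2) 1) := by
  have hSfin : volume S ≠ ⊤ := ((measure_mono h2).trans_lt measure_ball_lt_top).ne
  calc volume.real (ball x R \ S) = volume.real (ball x R) - volume.real S :=
        measureReal_sdiff h2 hS measure_ball_lt_top.ne
    _ ≤ volume.real (ball x R) - volume.real (ball x (R - a)) := by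
        have : volume.real (ball x (R - a)) ≤ volume.real S := measureReal_mono h1 hSfin
        linarith
    _ ≤ _ := volume_real_ball_sub_le_E2 x ha haR

/-! ### Uniform slice near-orthogonality of a localized plane wave -/

namespace WaveData

variable (d : WaveData)

/-- The main term `A χ osc D` is compactly supported. [folklore] -/
theorem hasCompactSupport_waveMain (N : ℝ) (i : Fin 4) : HasCompactSupport (d.waveMain N i) := by
  have : d.waveMain N i = fun z => d.cutoff z * (d.A * osc d.η N 3 z * d.Dvec i) := by
    funext z; simp only [waveMain]; ring
  rw [this]
  exact d.hasCompactSupport_cutoff.mul_right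

/-- A uniform bound of the derivative of the cutoff. [folklore] -/
theorem exists_norm_fderiv_cutoff_le : ∃ K : ℝ, 0 ≤ K ∧ ∀ z, ‖fderiv ℝ d.cutoff z‖ ≤ K := by
  have hc : Continuous (fderiv ℝ d.cutoff) := d.contDiff_cutoff.continuous_fderiv (by simp)
  have hs : HasCompactSupport (fderiv ℝ d.cutoff) := d.hasCompactSupport_cutoff.fderiv (𝕜 := ℝ)
  obtain ⟨K, hK⟩ := hc.bounded_above_of_compact_support hs
  exact ⟨max K 0, le_max_right _ _, fun z => (hK z).trans (le_max_left _ _)⟩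

/-- Off the spatial disc the slices of the wave and of its main term agree (both vanish).
[folklore] -/
theorem wave_sub_waveMain_slice_eq_zero {N : ℝ} {i : Fin 4} {t : ℝ} {x : E2}
    (hx : x ∉ ball d.c.2 d.r) : d.wave N i (t, x) - d.waveMain N i (t, x) = 0 := by
  rw [d.wave_slice_eq_zero hx, d.waveMain_slice_eq_zero hx, sub_zero]

/-- **Near-orthogonality of the slices of a localized plane wave to all normalized `C¹`
amplitudes, uniformly in time** (DLSz 2010, §4.5 Step 3 and Lemma 4.9, in quantitative form):
for every `ε > 0`, eventually in the frequency `N`, for every time `t` and every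
`g ∈ C¹(ℝ²)` with `|g| ≤ 1` and `‖Dg‖ ≤ 1`, `|∫ wave_N,i(t,x) g(x) dx| ≤ ε`. One integration by
parts in `x` along the spatial part `ξ` of the frequency (which is a unit vector) bounds the
main term by `(‖Dχ‖_∞ + 1) |B_r| |A D_i| / N`; the remainder `wave - A χ osc D` is uniformly
`O(1/N)`. [cite: DeLellisSzekelyhidi2010, Lemma 4.9 and §4.5 (Step 3)] -/
theorem wave_slice_integral_uniform_eventually (i : Fin 4) {ε : ℝ} (hε : 0 < ε) :
    ∀ᶠ N : ℝ in atTop, ∀ (t : ℝ) (g : E2 → ℝ), ContDiff ℝ 1 g → (∀ x, |g x| ≤ 1) →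
      (∀ x, ‖fderiv ℝ g x‖ ≤ 1) → |∫ x, d.wave N i (t, x) * g x| ≤ ε := by
  -- constants
  set v : E2 := d.η.2 with hv_def
  have hv : phaseL d.η (dXv v) ≠ 0 := by
    rw [phaseL_dXv, real_inner_self_eq_norm_sq]
    exact pow_ne_zero 2 (norm_ne_zero_iff.mpr d.η_snd_ne_zero)
  have hph : 0 < |phaseL d.η (dXv v)| := abs_pos.mpr hv
  obtain ⟨Kχ, hKχ0, hKχ⟩ := d.exists_norm_fderiv_cutoff_le
  set Vr : ℝ := volume.real (ball d.c.2 d.r) with hVr_def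
  have hVr : 0 ≤ Vr := measureReal_nonneg
  set L : ℝ := (Kχ + 1) * ‖v‖ with hL_def
  have hL : 0 ≤ L := by positivity
  set KA : ℝ := |d.A * d.Dvec i| with hKA_def
  have hKA : 0 ≤ KA := abs_nonneg _
  -- the remainder tolerance and the frequency threshold
  set ρ : ℝ := ε / 2 / (Vr + 1) with hρ_def
  have hρ : 0 < ρ := by positivity
  have hρV : ρ * Vr ≤ ε / 2 := by
    rw [hρ_def, div_mul_eq_mul_div, div_le_iff₀ (by positivity)]
    nlinarith
  set N₀ : ℝ := KA * L * Vr / (ε / 2 * |phaseL d.η (dXv v)|) + 1 with hN₀_def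
  filter_upwards [d.wave_eventually_close hρ, eventually_ge_atTop N₀, eventually_gt_atTop (0 : ℝ)]
    with N hclose hN hN0 t g hg hg1 hdg1
  -- the amplitude `F = χ · g`
  set F : ST → ℝ := fun z => d.cutoff z * g z.2 with hF_def
  have hχ1 : ContDiff ℝ 1 d.cutoff := d.contDiff_cutoff.of_le one_le_infty
  have hG1 : ContDiff ℝ 1 (fun z : ST => g z.2) := hg.comp contDiff_snd
  have hF1 : ContDiff ℝ 1 F := hχ1.mul hG1
  have hFc : HasCompactSupport F := d.hasCompactSupport_cutoff.mul_right
  -- pointwise bound of `∂_{(0,v)} F`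
  have hpd : ∀ z, |pd (dXv v) F z| ≤ L := by
    intro z
    have hdχ : DifferentiableAt ℝ d.cutoff z := (hχ1.differentiable one_ne_zero) z
    have hdG : DifferentiableAt ℝ (fun z : ST => g z.2) z := (hG1.differentiable one_ne_zero) z
    have hdg : DifferentiableAt ℝ g z.2 := (hg.differentiable one_ne_zero) z.2
    rw [pd_apply, hF_def, fderiv_fun_mul hdχ hdG]
    simp only [FunLike.coe_add, Pi.add_apply, FunLike.coe_smul, Pi.smul_apply, smul_eq_mul]
    have hcomp : fderiv ℝ (fun z : ST => g z.2) z (dXv v) = fderiv ℝ g z.2 v := by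
      have : (fun z : ST => g z.2) = g ∘ Prod.snd := rfl
      rw [this, fderiv_comp z hdg differentiableAt_snd, fderiv_snd]
      simp [dXv]
    rw [hcomp]
    have h1 : |d.cutoff z * fderiv ℝ g z.2 v| ≤ ‖v‖ := by
      rw [abs_mul]
      calc |d.cutoff z| * |fderiv ℝ g z.2 v| ≤ 1 * (‖fderiv ℝ g z.2‖ * ‖v‖) := by
            refine mul_le_mul (d.abs_cutoff_le_one z) ?_ (abs_nonneg _) zero_le_one
            rw [← Real.norm_eq_abs]; exact ContinuousLinearMap.le_opNorm _ _
        _ ≤ 1 * (1 * ‖v‖) := by gcongr; exact hdg1 z.2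
        _ = ‖v‖ := by ring
    have h2 : |g z.2 * fderiv ℝ d.cutoff z (dXv v)| ≤ Kχ * ‖v‖ := by
      rw [abs_mul]
      calc |g z.2| * |fderiv ℝ d.cutoff z (dXv v)| ≤ 1 * (‖fderiv ℝ d.cutoff z‖ * ‖dXv v‖) := by
            refine mul_le_mul (hg1 z.2) ?_ (abs_nonneg _) zero_le_one
            rw [← Real.norm_eq_abs]; exact ContinuousLinearMap.le_opNorm _ _
        _ ≤ 1 * (Kχ * ‖v‖) := by
            gcongr
            · exact hKχ z
            · simp [dXv, Prod.norm_def]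
        _ = Kχ * ‖v‖ := by ring
    calc |d.cutoff z * fderiv ℝ g z.2 v + g z.2 * fderiv ℝ d.cutoff z (dXv v)|
        ≤ |d.cutoff z * fderiv ℝ g z.2 v| + |g z.2 * fderiv ℝ d.cutoff z (dXv v)| := abs_add_le _ _
      _ ≤ ‖v‖ + Kχ * ‖v‖ := add_le_add h1 h2
      _ = L := by rw [hL_def]; ring
  -- `∂_{(0,v)} F` vanishes off the spatial disc on every slice
  have hpd0 : ∀ x, x ∉ ball d.c.2 d.r → |pd (dXv v) F (t, x)| = 0 := by
    intro x hx
    rw [abs_eq_zero]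
    apply pd_eq_zero_of_notMem
    intro hmem
    have h1 : (t, x) ∈ tsupport d.cutoff := tsupport_mul_subset_left hmem
    have h2 := d.tsupport_cutoff_subset_ball h1
    rw [mem_ball, Prod.dist_eq, max_lt_iff] at h2
    exact hx (mem_ball.mpr h2.2)
  have hint_pd : ∫ x, |pd (dXv v) F (t, x)| ≤ L * Vr := by
    rw [← setIntegral_eq_integral_of_forall_compl_eq_zero hpd0]
    have h := norm_setIntegral_le_of_norm_le_const (μ := volume) (s := ball d.c.2 d.r)
      (f := fun x => |pd (dXv v) F (t, x)|) measure_ball_lt_top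
      (fun x _ => by rw [Real.norm_eq_abs, abs_abs]; exact hpd (t, x))
    rw [Real.norm_eq_abs, abs_of_nonneg (integral_nonneg fun x => abs_nonneg _)] at h
    exact h
  -- the main term
  have hmain : |∫ x, F (t, x) * osc d.η N 3 (t, x)| ≤ L * Vr / (N * |phaseL d.η (dXv v)|) :=
    (abs_integral_slice_mul_osc_le hF1 hFc d.η hN0 3 hv t).trans (by gcongr)
  have hmain' : KA * |∫ x, F (t, x) * osc d.η N 3 (t, x)| ≤ ε / 2 := by
    have hNpos : 0 < N * |phaseL d.η (dXv v)| := mul_pos hN0 hph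
    calc KA * |∫ x, F (t, x) * osc d.η N 3 (t, x)| ≤ KA * (L * Vr / (N * |phaseL d.η (dXv v)|)) :=
          mul_le_mul_of_nonneg_left hmain hKA
      _ = KA * L * Vr / (N * |phaseL d.η (dXv v)|) := by ring
      _ ≤ ε / 2 := by
          rw [div_le_iff₀ hNpos]
          have hN' : KA * L * Vr / (ε / 2 * |phaseL d.η (dXv v)|) ≤ N - 1 := by linarith
          have := (div_le_iff₀ (by positivity : 0 < ε / 2 * |phaseL d.η (dXv v)|)).mp hN'
          nlinarith [hph, hε]
  -- the remainder
  have hrem0 : ∀ x, x ∉ ball d.c.2 d.r →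
      |(d.wave N i (t, x) - d.waveMain N i (t, x)) * g x| = 0 := by
    intro x hx
    rw [d.wave_sub_waveMain_slice_eq_zero hx, zero_mul, abs_zero]
  have hrem : |∫ x, (d.wave N i (t, x) - d.waveMain N i (t, x)) * g x| ≤ ρ * Vr := by
    calc _ ≤ ∫ x, |(d.wave N i (t, x) - d.waveMain N i (t, x)) * g x| := abs_integral_le_integral_abs
      _ = ∫ x in ball d.c.2 d.r, |(d.wave N i (t, x) - d.waveMain N i (t, x)) * g x| :=
          (setIntegral_eq_integral_of_forall_compl_eq_zero hrem0).symm
      _ ≤ ρ * Vr := by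
          have h := norm_setIntegral_le_of_norm_le_const (μ := volume) (s := ball d.c.2 d.r)
            (f := fun x => |(d.wave N i (t, x) - d.waveMain N i (t, x)) * g x|) measure_ball_lt_top
            (C := ρ) (fun x _ => by
              rw [Real.norm_eq_abs, abs_abs, abs_mul]
              calc _ ≤ ρ * 1 := mul_le_mul (hclose i (t, x)) (hg1 x) (abs_nonneg _) hρ.le
                _ = ρ := mul_one ρ)
          rw [Real.norm_eq_abs, abs_of_nonneg (integral_nonneg fun x => abs_nonneg _)] at h
          exact h
  -- integrability of the two pieces on the slice
  have hgc : Continuous g := hg.continuous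
  have hI1 : Integrable (fun x => d.A * d.Dvec i * (F (t, x) * osc d.η N 3 (t, x))) := by
    refine (integrable_slice (G := fun z => F z * osc d.η N 3 z) ?_ hFc.mul_right t).const_mul _
    exact hF1.continuous.mul (contDiff_osc _ _ _).continuous
  have hI2 : Integrable (fun x => (d.wave N i (t, x) - d.waveMain N i (t, x)) * g x) := by
    refine integrable_slice (G := fun z => (d.wave N i z - d.waveMain N i z) * g z.2) ?_ ?_ t
    · exact ((d.continuous_wave N i).sub (d.continuous_waveMain N i)).mul (hgc.comp continuous_snd)
    · exact ((d.hasCompactSupport_wave N i).sub (d.hasCompactSupport_waveMain N i)).mul_right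
  -- assemble
  have hsplit : ∀ x, d.wave N i (t, x) * g x
      = d.A * d.Dvec i * (F (t, x) * osc d.η N 3 (t, x))
        + (d.wave N i (t, x) - d.waveMain N i (t, x)) * g x := by
    intro x; simp only [waveMain, hF_def]; ring
  simp_rw [hsplit]
  rw [integral_add hI1 hI2, integral_const_mul]
  calc _ ≤ |d.A * d.Dvec i * ∫ x, F (t, x) * osc d.η N 3 (t, x)|
        + |∫ x, (d.wave N i (t, x) - d.waveMain N i (t, x)) * g x| := abs_add_le _ _
    _ ≤ ε / 2 + ρ * Vr := by
        refine add_le_add ?_ hrem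
        rw [abs_mul]; exact hmain'
    _ ≤ ε / 2 + ε / 2 := by linarith
    _ = ε := by ring

/-- The normalization removed: eventually in `N`, for all `t` and all `g ∈ C¹(ℝ²)` with
`|g| ≤ K₀` and `‖Dg‖ ≤ K₀` (`K₀ ≥ 0`), `|∫ wave_N,i(t,x) g(x) dx| ≤ ε K₀`. [folklore] -/
theorem wave_slice_integral_uniform_eventually' (i : Fin 4) {ε : ℝ} (hε : 0 < ε) :
    ∀ᶠ N : ℝ in atTop, ∀ (t : ℝ) (g : E2 → ℝ) (K₀ : ℝ), 0 ≤ K₀ → ContDiff ℝ 1 g →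
      (∀ x, |g x| ≤ K₀) → (∀ x, ‖fderiv ℝ g x‖ ≤ K₀) → |∫ x, d.wave N i (t, x) * g x| ≤ ε * K₀ := by
  filter_upwards [d.wave_slice_integral_uniform_eventually i hε] with N hN t g K₀ hK₀ hg hgK hdgK
  rcases hK₀.eq_or_lt with hK | hK
  · -- `K₀ = 0`: `g = 0`
    have hg0 : ∀ x, g x = 0 := fun x => abs_nonpos_iff.mp (hK ▸ hgK x)
    simp [hg0, ← hK]
  · have h := hN t (fun x => K₀⁻¹ * g x) (contDiff_const.mul hg) (fun x => by
        rw [abs_mul, abs_inv, abs_of_pos hK, inv_mul_le_iff₀ hK, mul_one]; exact hgK x)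
      (fun x => by
        rw [fderiv_const_mul ((hg.differentiable one_ne_zero) x), norm_smul, norm_inv,
          Real.norm_eq_abs, abs_of_pos hK, inv_mul_le_iff₀ hK, mul_one]
        exact hdgK x)
    have e : ∫ x, d.wave N i (t, x) * (K₀⁻¹ * g x) = K₀⁻¹ * ∫ x, d.wave N i (t, x) * g x := by
      rw [← integral_const_mul]
      refine integral_congr_ae (Eventually.of_forall fun x => ?_)
      simp only; ring
    rw [e, abs_mul, abs_inv, abs_of_pos hK, inv_mul_le_iff₀ hK] at h
    linarith [mul_comm ε K₀]

end WaveData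

end Literature.Analysis.FluidPDE.ConvexIntegration
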